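/-
Copyright (c) 2026 the pub-hodgecm-mathlib formalisation cell (harness21).  Prover seat hodgecm-mathlib-LH4-p04 (g3), req620 Track A «(D-RAM) FOUR-FRAME» squad
(unit U2H_HSide, the (ρ2b′-X) payer road (payer lineage LH4-p14, HEAD-OF-ORGANS MAP v1 seam S7 «T5s re-cut owed: top bit + 2n_H = jl»); letters of record = LH4-p08 (g4)
T5a sheet v5 (DIFF DONE 04:43Z against LH4-r01 (g5)'s d ∈ {4,5} PER tables); dealer∕pen LH4-plan (g12) WORD #21∕#22; heir LEAD F0P3a-plan (g20) T19-01 (5)(a) ∕ T19-02 (R-25)).  2026-09-04.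
-/
import Summits.HodgeConjecture.HodgeConjecture.Theorems.F0P3cDyRamToricCensusSumUnrParts   -- ★ p857337 (this seat): `low_block_mul`; brings ★ p857321 (re-indexing tools, geometric ∕ alternating sums)
import HarnessLib

/-!
# Crux `H413`, line LH4 «(D-RAM) FOUR-FRAME» road — unit U2H (ii-H), the (ρ2b′-X) payer: O-Sum ∕ T5s «TORIC CENSUS SUM», TYPE U, SHEET-v5 LETTERS — FILE 1∕2 «PARTS»:
# the cell evaluations (`+` column, `−` row) and the two sides summed in closed form, under the CORRECTED TOP BITS `2j + d ≤ 2jl + 1`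

Cell `hodgecm-mathlib` (D-0151), FLOOR 0, crux item H413 = `stmt-HodgeConjecture-24833`; squad F0∕P3c∕LH4; registered stub served: `F0P3cDyRamFourFrameU2H.stub_U2H_fixedPointCensus_typeTwo_unit0`
((ρ2b′-X), U2H ED. 15 :418) through the ★ spine p857061 ∘ p857119 ∘ layer 4′ (`hOrgNV`) and the payer lineage's head-of-organs (MAP v1 seam S7).  THEOREMS ONLY (no `def`, no instance,
no notation, no `sorry`, default heartbeats); lane `--supports stmt-HodgeConjecture-24833 --as helper` (count-neutral).  Pure finite-sum bookkeeping over `ℚ`; the tools are ★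
`…ToricCensusSumUnrBlocks` (p857321) and ★ `…ToricCensusSumUnrParts.low_block_mul` (p857337), imported, not restated.

WHY A RE-CUT.  ★ `…ToricCensusSumUnr.toricCensusSum_unr` (p857350) is the identity for the T5a sheet-v3 families (top bits `j < jl`, binder `n_H = (jl + S − 2)∕2`) — the `S = 2`
shadow of the law (d ≤ 3, where `(jl + S − 2)∕2 = jl∕2`).  LH4-r01 (g5)'s d ∈ {4,5} engine tables and LH4-p08 (g4)'s cell-by-cell diff (48∕48) fix the TOP BIT as
`[2j + d ≤ 2jl + 1]` (the depth `jl − d + 1` at which `κ` dies in `T_M∕T♮`, Serre V §3 for M∕K ramified) and the H-level binder as `2n_H = jl`; the token side gains the visible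
condition `S − 1 ≤ m` (the rows with `m ≤ S − 2` are outside every deep `V`).  Everything else (u-free level tables, LOW law, magnitudes `φ±`) is unchanged.

CONTENT.  `colP_eval_v5` (TOP cell alive iff `⌊m∕2⌋ < a`, `2a + d ≤ 2m + 1`, worth `(x+1)x^{a+d+u⋆+⌊m∕2⌋−1}`), `rowM_eval_v5` (− TOP alive iff `d + ⌊m∕2⌋ ≤ j`, `2j + d ≤ 2jl + 1`),
`sumP_eval_v5` (TOP block `(x+1)x^{⌊m∕2⌋+1+E}Σ_{i < (2m+1−d)∕2 − ⌊m∕2⌋} x^i`), `sumM_eval_v5` (TOP block `(x+1)x^{d+m−1}Σ_{i < (2jl+1−d)∕2 + 1 − d − ⌊m∕2⌋} x^i`).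
HONEST LABEL.  Count-neutral (`--supports`); nothing printed is asserted; (ρ2b′-X) `stub_U2H_fixedPointCensus_typeTwo_unit0` (U2H :418) stays a PROVER TARGET (an empirical
census law, kit-confirmed; (R-25): organ road measured at `tE = 2`, `tE ≠ 2` a named open sub-case) until its payer lands; `HC_CM` is proved only modulo the 7 printed citations
(2 remaining named inputs: hLiu418 = `stmt-HodgeConjecture-24832`, h413 = `stmt-HodgeConjecture-24833`) until rung 0 closes.

## References
* [Kottwitz1986BaseChangeUnits] R. E. Kottwitz, *Base change for unit elements of Hecke algebras*, Compositio Math. 60 (1986), §1 pp. 240–241 (orbital integrals of units as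
  lattice counts modulo the torus).
* [Rogawski1990] J. D. Rogawski, *Automorphic Representations of Unitary Groups in Three Variables*, Ann. of Math. Stud. 123 (1990), §4.9 Prop. 4.9.1 (b) p. 55, Lemma 4.9.3 p. 56
  (the fixed-point census of a type-(2) element; the toric decomposition).
-/

set_option autoImplicit false

namespace Summit.HodgeConjecture.HodgeConjecture.Cruxes.H413.F0P3cDyRamToricCensusSumUnrV5Parts

open Finset
open Summit.HodgeConjecture.HodgeConjecture.Cruxes.H413.F0P3cDyRamToricCensusSumUnrBlocks (sum_range_parity_reindex sum_range_window_reindex sum_range_ray_single geom_sum_mul' geom_sum_two_mul alt_index_sum)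
open Summit.HodgeConjecture.HodgeConjecture.Cruxes.H413.F0P3cDyRamToricCensusSumUnrParts (low_block_mul)

/-- **THE `+` COLUMN `a ≥ 1`** of the type-U census: the cells live on the parity ray `j = a + d + 2u`; off the diagonal and on its low half they are alive iff `2a ≤ m`
and `2a + d + 2u ≤ jl` (a geometric block), the TOP diagonal cell (`m < 2a`, sheet-v5 top bit `(d + m ≤ jl ∧ jl − d − m even) ∧ 2j + d ≤ 2jl + 1`, i.e. `2a + d ≤ 2m + 1`) is worth `(x+1)·x^{a + d + u⋆ + ⌊m∕2⌋ − 1}`, `u⋆ = (jl − m − d)∕2`. [folklore] -/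
theorem colP_eval_v5 (x : ℚ) (hx0 : x ≠ 0) (hx1 : x ≠ 1) {d jl m : ℕ} (hd : 2 ≤ d) (hm : m ≤ jl)
    (nP vP : ℕ → ℕ → ℚ)
    (hnP : ∀ j a, 1 ≤ a → nP j a = if a + d ≤ j ∧ (j - a - d) % 2 = 0 then (x ^ 2 - 1) * x ^ (j - 2 - (j - a - d) / 2) else 0)
    (hvOffP : ∀ j a, 1 ≤ a → j + m ≠ jl + a → vP j a = if 2 * a ≤ m ∧ (j + a ≤ m ∨ j + a ≤ jl) then nP j a else 0)
    (hvLowP : ∀ j a, 1 ≤ a → j + m = jl + a → 2 * a ≤ m → vP j a = nP j a)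
    (hvTopP : ∀ j a, 1 ≤ a → j + m = jl + a → m < 2 * a →
      vP j a = if (d + m ≤ jl ∧ (jl - d - m) % 2 = 0) ∧ 2 * j + d ≤ 2 * jl + 1 then nP j a / ((x - 1) * x ^ ((2 * a - m + 1) / 2 - 1)) else 0)
    (a : ℕ) (ha : 1 ≤ a) :
    ∑ j ∈ range (jl + 1), x ^ a * vP j a =
      (if 2 * a ≤ m ∧ 2 * a + d ≤ jl then (x ^ 2 - 1) * x ^ (2 * a + d - 2) * ∑ u ∈ range ((jl - d) / 2 - a + 1), x ^ u else 0) +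
      (if m < 2 * a ∧ 2 * a + d ≤ 2 * m + 1 ∧ m + d ≤ jl ∧ (jl - m - d) % 2 = 0 then (x + 1) * x ^ (a + d + (jl - m - d) / 2 + m / 2 - 1) else 0) := by
  -- (1) the column lives on the parity ray `j = a + d + 2u`
  have hzero : ∀ j, ¬ (a + d ≤ j ∧ (j - a - d) % 2 = 0) → vP j a = 0 := by
    intro j hj
    have hn : nP j a = 0 := by rw [hnP j a ha, if_neg hj]
    by_cases hdiag : j + m = jl + a
    · by_cases hlow : 2 * a ≤ m
      · rw [hvLowP j a ha hdiag hlow, hn]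
      · rw [hvTopP j a ha hdiag (by omega), hn, zero_div]; split_ifs <;> rfl
    · rw [hvOffP j a ha hdiag, hn]; split_ifs <;> rfl
  have hcol : ∀ j ∈ range (jl + 1), x ^ a * vP j a = if a + d ≤ j ∧ (j - (a + d)) % 2 = 0 then x ^ a * vP j a else 0 := by
    intro j _
    by_cases h : a + d ≤ j ∧ (j - (a + d)) % 2 = 0
    · rw [if_pos h]
    · rw [if_neg h, hzero j (fun h' => h ⟨h'.1, by rw [← Nat.sub_sub]; exact h'.2⟩), mul_zero]
  rw [Finset.sum_congr rfl hcol, sum_range_parity_reindex (fun j => x ^ a * vP j a) (a + d) jl]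
  -- (2) the cell values on the ray
  have hnray : ∀ u, nP (a + d + 2 * u) a = (x ^ 2 - 1) * x ^ (a + d + u - 2) := by
    intro u
    rw [hnP _ a ha, if_pos ⟨by omega, by omega⟩]
    congr 2; omega
  have hlowval : ∀ u, x ^ a * ((x ^ 2 - 1) * x ^ (a + d + u - 2)) = (x ^ 2 - 1) * x ^ (2 * a + d - 2) * x ^ u := by
    intro u
    have e : a + (a + d + u - 2) = (2 * a + d - 2) + u := by omega
    calc x ^ a * ((x ^ 2 - 1) * x ^ (a + d + u - 2)) = (x ^ 2 - 1) * x ^ (a + (a + d + u - 2)) := by rw [pow_add]; ring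
      _ = (x ^ 2 - 1) * x ^ (2 * a + d - 2) * x ^ u := by rw [e, pow_add]; ring
  have htopval : ∀ u, m < 2 * a → x ^ a * ((x ^ 2 - 1) * x ^ (a + d + u - 2) / ((x - 1) * x ^ ((2 * a - m + 1) / 2 - 1))) =
      (x + 1) * x ^ (a + d + u + m / 2 - 1) := by
    intro u hma
    have hden : (x - 1) * x ^ ((2 * a - m + 1) / 2 - 1) ≠ 0 := mul_ne_zero (sub_ne_zero.2 hx1) (pow_ne_zero _ hx0)
    rw [← mul_div_assoc, div_eq_iff hden]
    have e : a + (a + d + u - 2) = (a + d + u + m / 2 - 1) + ((2 * a - m + 1) / 2 - 1) := by omega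
    calc x ^ a * ((x ^ 2 - 1) * x ^ (a + d + u - 2)) = (x ^ 2 - 1) * x ^ (a + (a + d + u - 2)) := by rw [pow_add]; ring
      _ = (x ^ 2 - 1) * (x ^ (a + d + u + m / 2 - 1) * x ^ ((2 * a - m + 1) / 2 - 1)) := by rw [e, pow_add]
      _ = (x + 1) * x ^ (a + d + u + m / 2 - 1) * ((x - 1) * x ^ ((2 * a - m + 1) / 2 - 1)) := by ring
  have hray : ∀ u, x ^ a * vP (a + d + 2 * u) a =
      (if 2 * a ≤ m then (if 2 * a + d + 2 * u ≤ jl then (x ^ 2 - 1) * x ^ (2 * a + d - 2) * x ^ u else 0) else 0) +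
      (if d + 2 * u = jl - m ∧ (m < 2 * a ∧ 2 * a + d ≤ 2 * m + 1) then (x + 1) * x ^ (a + d + u + m / 2 - 1) else 0) := by
    intro u
    by_cases hlow : 2 * a ≤ m
    · rw [if_pos hlow, if_neg (show ¬ (d + 2 * u = jl - m ∧ (m < 2 * a ∧ 2 * a + d ≤ 2 * m + 1)) from fun h => absurd h.2.1 (by omega)), add_zero]
      by_cases hdiag : a + d + 2 * u + m = jl + a
      · rw [hvLowP _ a ha hdiag hlow, hnray, hlowval, if_pos (by omega)]
      · rw [hvOffP _ a ha hdiag, hnray]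
        by_cases hal : 2 * a + d + 2 * u ≤ jl
        · rw [if_pos ⟨hlow, by omega⟩, if_pos hal, hlowval]
        · rw [if_neg (by omega), if_neg hal, mul_zero]
    · rw [if_neg hlow, zero_add]
      by_cases hdiag : a + d + 2 * u + m = jl + a
      · rw [hvTopP _ a ha hdiag (by omega), hnray]
        by_cases hc : 2 * a + d ≤ 2 * m + 1
        · rw [if_pos (show (d + m ≤ jl ∧ (jl - d - m) % 2 = 0) ∧ 2 * (a + d + 2 * u) + d ≤ 2 * jl + 1 from ⟨⟨by omega, by omega⟩, by omega⟩),
            htopval u (by omega), if_pos ⟨by omega, by omega, hc⟩]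
        · rw [if_neg (show ¬ ((d + m ≤ jl ∧ (jl - d - m) % 2 = 0) ∧ 2 * (a + d + 2 * u) + d ≤ 2 * jl + 1) from fun h => hc (by omega)), mul_zero,
            if_neg (fun h => hc h.2.2)]
      · rw [hvOffP _ a ha hdiag, if_neg (fun h => hlow h.1), mul_zero, if_neg (fun h => hdiag (by omega))]
  simp_rw [hray]
  rw [Finset.sum_add_distrib]
  congr 1
  · -- (3a) the low block
    by_cases hlow : 2 * a ≤ m
    · simp_rw [if_pos hlow]
      by_cases htop : 2 * a + d ≤ jl
      · rw [if_pos ⟨hlow, htop⟩, ← Finset.sum_filter]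
        have hset : (range ((jl + 2 - (a + d)) / 2)).filter (fun u => 2 * a + d + 2 * u ≤ jl) = range ((jl - d) / 2 - a + 1) := by
          ext u
          simp only [Finset.mem_filter, Finset.mem_range]
          omega
        rw [hset, Finset.mul_sum]
      · rw [if_neg (fun h => htop h.2)]
        refine Finset.sum_eq_zero fun u _ => ?_
        rw [if_neg (by omega)]
    · simp_rw [if_neg hlow]
      rw [Finset.sum_const_zero, if_neg (fun h => hlow h.1)]
  · -- (3b) the top cell
    rw [sum_range_ray_single (fun u => (x + 1) * x ^ (a + d + u + m / 2 - 1)) (fun _ => m < 2 * a ∧ 2 * a + d ≤ 2 * m + 1) d (jl - m)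
      ((jl + 2 - (a + d)) / 2)]
    by_cases hc : m < 2 * a ∧ 2 * a + d ≤ 2 * m + 1 ∧ m + d ≤ jl ∧ (jl - m - d) % 2 = 0
    · obtain ⟨h1, h2, h4, h5⟩ := hc
      rw [if_pos (show m < 2 * a ∧ 2 * a + d ≤ 2 * m + 1 ∧ m + d ≤ jl ∧ (jl - m - d) % 2 = 0 from ⟨h1, h2, h4, h5⟩),
        if_pos (show d ≤ jl - m ∧ (jl - m - d) % 2 = 0 ∧ (jl - m - d) / 2 < (jl + 2 - (a + d)) / 2 ∧ (m < 2 * a ∧ 2 * a + d ≤ 2 * m + 1) from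
          ⟨by omega, by omega, by omega, h1, h2⟩)]
    · rw [if_neg hc, if_neg (show ¬ (d ≤ jl - m ∧ (jl - m - d) % 2 = 0 ∧ (jl - m - d) / 2 < (jl + 2 - (a + d)) / 2 ∧ (m < 2 * a ∧ 2 * a + d ≤ 2 * m + 1)) from
        fun h => hc ⟨h.2.2.2.1, h.2.2.2.2, by omega, h.2.1⟩)]

/-- **THE `−` ROW `j`** of the type-U census: one cell per row — below the conductor the `a = 0` cell of the rows with `j ≢ d (mod 2)`, from `j = d` on the cell
`a = j + 1 − d`: alive (worth `(x+1)·x^{2j−d}`) while `j ≤ d − 1 + ⌊m∕2⌋`, and on the `−` diagonal (sheet-v5 top bit `jl + 1 = d + m ∧ 2j + d ≤ 2jl + 1`) the TOP cells `(x+1)·x^{j + ⌈m∕2⌉ − 1}`, `j < jl`. [folklore] -/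
theorem rowM_eval_v5 (x : ℚ) (hx0 : x ≠ 0) {d jl m : ℕ} (hd : 2 ≤ d) (hm : m ≤ jl - d + 1) (hdjl : d ≤ jl)
    (nM vM : ℕ → ℕ → ℚ)
    (hnM : ∀ j a, nM j a = if (d ≤ j + 1 ∧ a + d = j + 1) ∨ (j + 1 < d ∧ a = 0 ∧ (j + d) % 2 = 1) then
      (if j = 0 then (1 : ℚ) else (x + 1) * x ^ (j - 1)) else 0)
    (hv0M : ∀ j, vM j 0 = nM j 0)
    (hvOffM : ∀ j a, 1 ≤ a → j + m ≠ jl + a → vM j a = if 2 * a ≤ m ∧ (j + a ≤ m ∨ j + a ≤ jl) then nM j a else 0)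
    (hvLowM : ∀ j a, 1 ≤ a → j + m = jl + a → 2 * a ≤ m → vM j a = nM j a)
    (hvTopM : ∀ j a, 1 ≤ a → j + m = jl + a → m < 2 * a → vM j a = if jl + 1 = d + m ∧ 2 * j + d ≤ 2 * jl + 1 then nM j a / x ^ ((2 * a - m) / 2) else 0)
    (j : ℕ) (hj : j ≤ jl) :
    ∑ a ∈ range (jl + 2), x ^ a * vM j a =
      (if j < d ∧ j % 2 ≠ d % 2 then (if j = 0 then (1 : ℚ) else (x + 1) * x ^ (j - 1)) else 0) +
      (if d ≤ j ∧ j ≤ d - 1 + m / 2 then (x + 1) * x ^ (2 * j - d) else 0) +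
      (if d + m / 2 ≤ j ∧ 2 * j + d ≤ 2 * jl + 1 ∧ jl + 1 = d + m then (x + 1) * x ^ (j + m - m / 2 - 1) else 0) := by
  -- a cell whose level count vanishes contributes nothing, whatever the depth rule
  have hzero : ∀ a, 1 ≤ a → nM j a = 0 → vM j a = 0 := by
    intro a ha hn
    by_cases hdiag : j + m = jl + a
    · by_cases hlow : 2 * a ≤ m
      · rw [hvLowM j a ha hdiag hlow, hn]
      · rw [hvTopM j a ha hdiag (by omega), hn, zero_div]; split_ifs <;> rfl
    · rw [hvOffM j a ha hdiag, hn]; split_ifs <;> rfl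
  by_cases hjd : j < d
  · -- below the conductor: only the `a = 0` cell
    rw [Finset.sum_eq_single 0, pow_zero, one_mul, hv0M, hnM, if_neg (show ¬ (d ≤ j ∧ j ≤ d - 1 + m / 2) from fun h => by omega),
      if_neg (show ¬ (d + m / 2 ≤ j ∧ 2 * j + d ≤ 2 * jl + 1 ∧ jl + 1 = d + m) from fun h => by omega), add_zero, add_zero]
    · by_cases hc : j % 2 ≠ d % 2
      · rw [if_pos (show (d ≤ j + 1 ∧ 0 + d = j + 1) ∨ (j + 1 < d ∧ (0 : ℕ) = 0 ∧ (j + d) % 2 = 1) from by omega),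
          if_pos (show j < d ∧ j % 2 ≠ d % 2 from ⟨hjd, hc⟩)]
      · rw [if_neg (show ¬ ((d ≤ j + 1 ∧ 0 + d = j + 1) ∨ (j + 1 < d ∧ (0 : ℕ) = 0 ∧ (j + d) % 2 = 1)) from by omega),
          if_neg (show ¬ (j < d ∧ j % 2 ≠ d % 2) from fun h => hc h.2)]
    · intro a _ ha0
      rw [hzero a (by omega) (by rw [hnM, if_neg (by omega)]), mul_zero]
    · intro h; exact absurd (Finset.mem_range.2 (by omega)) h
  · -- from the conductor on: only the cell `a = j + 1 − d`
    rw [not_lt] at hjd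
    have hj1 : j ≠ 0 := by omega
    rw [Finset.sum_eq_single (j + 1 - d), if_neg (show ¬ (j < d ∧ j % 2 ≠ d % 2) from fun h => by omega), zero_add]
    · have hn : nM j (j + 1 - d) = (x + 1) * x ^ (j - 1) := by rw [hnM, if_pos (Or.inl ⟨by omega, by omega⟩), if_neg hj1]
      by_cases hlow : 2 * (j + 1 - d) ≤ m
      · -- a LOW cell (diagonal or not): alive
        have hv : vM j (j + 1 - d) = nM j (j + 1 - d) := by
          by_cases hdiag : j + m = jl + (j + 1 - d)
          · exact hvLowM j _ (by omega) hdiag hlow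
          · rw [hvOffM j _ (by omega) hdiag, if_pos ⟨hlow, Or.inr (by omega)⟩]
        rw [hv, hn, if_pos (show d ≤ j ∧ j ≤ d - 1 + m / 2 from ⟨hjd, by omega⟩),
          if_neg (show ¬ (d + m / 2 ≤ j ∧ 2 * j + d ≤ 2 * jl + 1 ∧ jl + 1 = d + m) from fun h => by omega), add_zero]
        have e : (j + 1 - d) + (j - 1) = 2 * j - d := by omega
        calc x ^ (j + 1 - d) * ((x + 1) * x ^ (j - 1)) = (x + 1) * x ^ ((j + 1 - d) + (j - 1)) := by rw [pow_add]; ring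
          _ = (x + 1) * x ^ (2 * j - d) := by rw [e]
      · -- a TOP cell: alive only on the `−` diagonal `jl + 1 = d + m`, below `jl`
        rw [if_neg (show ¬ (d ≤ j ∧ j ≤ d - 1 + m / 2) from fun h => by omega), zero_add]
        by_cases hdiag : j + m = jl + (j + 1 - d)
        · rw [hvTopM j _ (by omega) hdiag (by omega), hn]
          by_cases hc : 2 * j + d ≤ 2 * jl + 1
          · rw [if_pos (show jl + 1 = d + m ∧ 2 * j + d ≤ 2 * jl + 1 from ⟨by omega, hc⟩),
              if_pos (show d + m / 2 ≤ j ∧ 2 * j + d ≤ 2 * jl + 1 ∧ jl + 1 = d + m from ⟨by omega, hc, by omega⟩),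
              ← mul_div_assoc, div_eq_iff (pow_ne_zero _ hx0)]
            have e : (j + 1 - d) + (j - 1) = (j + m - m / 2 - 1) + (2 * (j + 1 - d) - m) / 2 := by omega
            calc x ^ (j + 1 - d) * ((x + 1) * x ^ (j - 1)) = (x + 1) * x ^ ((j + 1 - d) + (j - 1)) := by rw [pow_add]; ring
              _ = (x + 1) * x ^ (j + m - m / 2 - 1) * x ^ ((2 * (j + 1 - d) - m) / 2) := by rw [e, pow_add]; ring
          · rw [if_neg (show ¬ (jl + 1 = d + m ∧ 2 * j + d ≤ 2 * jl + 1) from fun h => hc h.2), mul_zero,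
              if_neg (show ¬ (d + m / 2 ≤ j ∧ 2 * j + d ≤ 2 * jl + 1 ∧ jl + 1 = d + m) from fun h => hc h.2.1)]
        · rw [hvOffM j _ (by omega) hdiag, if_neg (fun h => hlow h.1), mul_zero,
            if_neg (show ¬ (d + m / 2 ≤ j ∧ 2 * j + d ≤ 2 * jl + 1 ∧ jl + 1 = d + m) from fun h => hdiag (by omega))]
    · intro a _ ha
      rcases Nat.eq_zero_or_pos a with rfl | hapos
      · rw [hv0M, hnM, if_neg (by omega), mul_zero]
      · rw [hzero a hapos (by rw [hnM, if_neg (by omega)]), mul_zero]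
    · intro h; exact absurd (Finset.mem_range.2 (by omega)) h

/-- **THE `+` SIDE SUMMED**: column `a = 0` (below ∕ above the conductor) + the LOW block + the TOP diagonal. [folklore] -/
theorem sumP_eval_v5 (x : ℚ) (hx0 : x ≠ 0) (hx1 : x ≠ 1) {d jl m : ℕ} (hd : 2 ≤ d) (hm : m ≤ jl) (hdjl : d ≤ jl)
    (nP vP : ℕ → ℕ → ℚ)
    (hnP : ∀ j a, 1 ≤ a → nP j a = if a + d ≤ j ∧ (j - a - d) % 2 = 0 then (x ^ 2 - 1) * x ^ (j - 2 - (j - a - d) / 2) else 0)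
    (hnP0 : ∀ j, nP j 0 = if (j + d) % 2 = 0 then (if d ≤ j then (x + 1) * x ^ ((j + d) / 2 - 1) else (if j = 0 then (1 : ℚ) else (x + 1) * x ^ (j - 1))) else 0)
    (hv0P : ∀ j, vP j 0 = nP j 0)
    (hvOffP : ∀ j a, 1 ≤ a → j + m ≠ jl + a → vP j a = if 2 * a ≤ m ∧ (j + a ≤ m ∨ j + a ≤ jl) then nP j a else 0)
    (hvLowP : ∀ j a, 1 ≤ a → j + m = jl + a → 2 * a ≤ m → vP j a = nP j a)
    (hvTopP : ∀ j a, 1 ≤ a → j + m = jl + a → m < 2 * a →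
      vP j a = if (d + m ≤ jl ∧ (jl - d - m) % 2 = 0) ∧ 2 * j + d ≤ 2 * jl + 1 then nP j a / ((x - 1) * x ^ ((2 * a - m + 1) / 2 - 1)) else 0) :
    ∑ j ∈ range (jl + 1), ∑ a ∈ range (jl + 2), x ^ a * vP j a =
      ∑ j ∈ range d, (if j % 2 = d % 2 then (if j = 0 then (1 : ℚ) else (x + 1) * x ^ (j - 1)) else 0) +
      (x + 1) * x ^ (d - 1) * ∑ u ∈ range ((jl - d) / 2 + 1), x ^ u +
      ∑ i ∈ range (min (m / 2) ((jl - d) / 2)), (x ^ 2 - 1) * x ^ (2 * i + d) * ∑ u ∈ range ((jl - d) / 2 - i), x ^ u +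
      (if m + d ≤ jl ∧ (jl - m - d) % 2 = 0 then
        (x + 1) * x ^ (m / 2 + 1 + (d + (jl - m - d) / 2 + m / 2 - 1)) * ∑ i ∈ range ((2 * m + 1 - d) / 2 - m / 2), x ^ i else 0) := by
  rw [Finset.sum_comm, Finset.sum_range_succ']
  -- the column `a = 0`
  have hcol0 : ∑ j ∈ range (jl + 1), x ^ 0 * vP j 0 =
      ∑ j ∈ range d, (if j % 2 = d % 2 then (if j = 0 then (1 : ℚ) else (x + 1) * x ^ (j - 1)) else 0) +
      (x + 1) * x ^ (d - 1) * ∑ u ∈ range ((jl - d) / 2 + 1), x ^ u := by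
    have hsplit : ∀ j ∈ range (jl + 1), x ^ 0 * vP j 0 =
        (if 0 ≤ j ∧ j < 0 + d then (if j % 2 = d % 2 then (if j = 0 then (1 : ℚ) else (x + 1) * x ^ (j - 1)) else 0) else 0) +
        (if d ≤ j ∧ (j - d) % 2 = 0 then (x + 1) * x ^ ((j + d) / 2 - 1) else 0) := by
      intro j _
      rw [pow_zero, one_mul, hv0P, hnP0]
      by_cases hjd : j < d
      · rw [if_pos (show 0 ≤ j ∧ j < 0 + d from ⟨Nat.zero_le _, by omega⟩), if_neg (show ¬ (d ≤ j ∧ (j - d) % 2 = 0) from fun h => by omega), add_zero]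
        by_cases hp : (j + d) % 2 = 0
        · rw [if_pos hp, if_pos (show j % 2 = d % 2 by omega), if_neg (by omega)]
        · rw [if_neg hp, if_neg (show ¬ (j % 2 = d % 2) from fun h => hp (by omega))]
      · rw [if_neg (show ¬ (0 ≤ j ∧ j < 0 + d) from fun h => by omega), zero_add]
        by_cases hp : (j + d) % 2 = 0
        · rw [if_pos hp, if_pos (by omega), if_pos (show d ≤ j ∧ (j - d) % 2 = 0 from ⟨by omega, by omega⟩)]
        · rw [if_neg hp, if_neg (show ¬ (d ≤ j ∧ (j - d) % 2 = 0) from fun h => hp (by omega))]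
    rw [Finset.sum_congr rfl hsplit, Finset.sum_add_distrib, sum_range_window_reindex _ (by omega : 0 + d ≤ jl + 1),
      sum_range_parity_reindex (fun j => (x + 1) * x ^ ((j + d) / 2 - 1)) d jl, Finset.mul_sum]
    congr 1
    · refine Finset.sum_congr rfl fun j _ => ?_
      rw [zero_add]
    · rw [show (jl + 2 - d) / 2 = (jl - d) / 2 + 1 by omega]
      refine Finset.sum_congr rfl fun u _ => ?_
      rw [show (d + 2 * u + d) / 2 - 1 = (d - 1) + u by omega, pow_add]
      ring
  -- the columns `a ≥ 1`
  have hcols : ∀ a ∈ range (jl + 1), ∑ j ∈ range (jl + 1), x ^ (a + 1) * vP j (a + 1) =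
      (if 0 ≤ a ∧ a < 0 + min (m / 2) ((jl - d) / 2) then (x ^ 2 - 1) * x ^ (2 * a + d) * ∑ u ∈ range ((jl - d) / 2 - a), x ^ u else 0) +
      (if m + d ≤ jl ∧ (jl - m - d) % 2 = 0 then
        (if m / 2 ≤ a ∧ a < m / 2 + ((2 * m + 1 - d) / 2 - m / 2) then (x + 1) * x ^ (m / 2 + 1 + (d + (jl - m - d) / 2 + m / 2 - 1)) * x ^ (a - m / 2) else 0) else 0) := by
    intro a _
    rw [colP_eval_v5 x hx0 hx1 hd hm nP vP hnP hvOffP hvLowP hvTopP (a + 1) (by omega)]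
    congr 1
    · by_cases hc : 2 * (a + 1) ≤ m ∧ 2 * (a + 1) + d ≤ jl
      · rw [if_pos hc, if_pos (show 0 ≤ a ∧ a < 0 + min (m / 2) ((jl - d) / 2) from ⟨Nat.zero_le _, by
            rw [zero_add, lt_min_iff]; omega⟩),
          show 2 * (a + 1) + d - 2 = 2 * a + d by omega, show (jl - d) / 2 - (a + 1) + 1 = (jl - d) / 2 - a by omega]
      · rw [if_neg hc, if_neg (show ¬ (0 ≤ a ∧ a < 0 + min (m / 2) ((jl - d) / 2)) from fun h => hc (by
            have := h.2; rw [zero_add, lt_min_iff] at this; omega))]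
    · by_cases hg : m + d ≤ jl ∧ (jl - m - d) % 2 = 0
      · rw [if_pos hg]
        by_cases hw : m < 2 * (a + 1) ∧ 2 * (a + 1) + d ≤ 2 * m + 1
        · rw [if_pos (show m < 2 * (a + 1) ∧ 2 * (a + 1) + d ≤ 2 * m + 1 ∧ m + d ≤ jl ∧ (jl - m - d) % 2 = 0 from ⟨hw.1, hw.2, hg⟩),
            if_pos (show m / 2 ≤ a ∧ a < m / 2 + ((2 * m + 1 - d) / 2 - m / 2) from by omega), mul_assoc, ← pow_add]
          congr 2; omega
        · rw [if_neg (show ¬ (m < 2 * (a + 1) ∧ 2 * (a + 1) + d ≤ 2 * m + 1 ∧ m + d ≤ jl ∧ (jl - m - d) % 2 = 0) from fun h => hw ⟨h.1, h.2.1⟩),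
            if_neg (show ¬ (m / 2 ≤ a ∧ a < m / 2 + ((2 * m + 1 - d) / 2 - m / 2)) from fun h => hw (by omega))]
      · rw [if_neg hg, if_neg (show ¬ (m < 2 * (a + 1) ∧ 2 * (a + 1) + d ≤ 2 * m + 1 ∧ m + d ≤ jl ∧ (jl - m - d) % 2 = 0) from
          fun h => hg ⟨h.2.2.1, h.2.2.2⟩)]
  rw [hcol0, Finset.sum_congr rfl hcols, Finset.sum_add_distrib,
    sum_range_window_reindex _ (by have := Nat.min_le_right (m / 2) ((jl - d) / 2); omega : 0 + min (m / 2) ((jl - d) / 2) ≤ jl + 1)]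
  have htop : ∑ a ∈ range (jl + 1), (if m + d ≤ jl ∧ (jl - m - d) % 2 = 0 then
      (if m / 2 ≤ a ∧ a < m / 2 + ((2 * m + 1 - d) / 2 - m / 2) then (x + 1) * x ^ (m / 2 + 1 + (d + (jl - m - d) / 2 + m / 2 - 1)) * x ^ (a - m / 2) else 0) else 0) =
      (if m + d ≤ jl ∧ (jl - m - d) % 2 = 0 then
        (x + 1) * x ^ (m / 2 + 1 + (d + (jl - m - d) / 2 + m / 2 - 1)) * ∑ i ∈ range ((2 * m + 1 - d) / 2 - m / 2), x ^ i else 0) := by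
    by_cases hg : m + d ≤ jl ∧ (jl - m - d) % 2 = 0
    · simp_rw [if_pos hg]
      rw [sum_range_window_reindex _ (by omega : m / 2 + ((2 * m + 1 - d) / 2 - m / 2) ≤ jl + 1), Finset.mul_sum]
      refine Finset.sum_congr rfl fun i _ => ?_
      rw [show m / 2 + i - m / 2 = i by omega]
    · simp_rw [if_neg hg]
      rw [Finset.sum_const_zero]
  rw [htop]
  simp_rw [zero_add]
  ring

/-- **THE `−` SIDE SUMMED**: the rows below the conductor + the LOW cells `d ≤ j ≤ d − 1 + ⌊m∕2⌋` + the TOP diagonal (`jl + 1 = d + m`). [folklore] -/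
theorem sumM_eval_v5 (x : ℚ) (hx0 : x ≠ 0) {d jl m : ℕ} (hd : 2 ≤ d) (hm : m ≤ jl - d + 1) (hdjl : d ≤ jl)
    (nM vM : ℕ → ℕ → ℚ)
    (hnM : ∀ j a, nM j a = if (d ≤ j + 1 ∧ a + d = j + 1) ∨ (j + 1 < d ∧ a = 0 ∧ (j + d) % 2 = 1) then
      (if j = 0 then (1 : ℚ) else (x + 1) * x ^ (j - 1)) else 0)
    (hv0M : ∀ j, vM j 0 = nM j 0)
    (hvOffM : ∀ j a, 1 ≤ a → j + m ≠ jl + a → vM j a = if 2 * a ≤ m ∧ (j + a ≤ m ∨ j + a ≤ jl) then nM j a else 0)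
    (hvLowM : ∀ j a, 1 ≤ a → j + m = jl + a → 2 * a ≤ m → vM j a = nM j a)
    (hvTopM : ∀ j a, 1 ≤ a → j + m = jl + a → m < 2 * a → vM j a = if jl + 1 = d + m ∧ 2 * j + d ≤ 2 * jl + 1 then nM j a / x ^ ((2 * a - m) / 2) else 0) :
    ∑ j ∈ range (jl + 1), ∑ a ∈ range (jl + 2), x ^ a * vM j a =
      ∑ j ∈ range d, (if j % 2 ≠ d % 2 then (if j = 0 then (1 : ℚ) else (x + 1) * x ^ (j - 1)) else 0) +
      (x + 1) * x ^ d * ∑ i ∈ range (m / 2), x ^ (2 * i) +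
      (if jl + 1 = d + m then (x + 1) * x ^ (d + m - 1) * ∑ i ∈ range ((2 * jl + 1 - d) / 2 + 1 - (d + m / 2)), x ^ i else 0) := by
  have hrows : ∀ j ∈ range (jl + 1), ∑ a ∈ range (jl + 2), x ^ a * vM j a =
      (if 0 ≤ j ∧ j < 0 + d then (if j % 2 ≠ d % 2 then (if j = 0 then (1 : ℚ) else (x + 1) * x ^ (j - 1)) else 0) else 0) +
      (if d ≤ j ∧ j < d + m / 2 then (x + 1) * x ^ d * x ^ (2 * (j - d)) else 0) +
      (if jl + 1 = d + m then
        (if d + m / 2 ≤ j ∧ j < d + m / 2 + ((2 * jl + 1 - d) / 2 + 1 - (d + m / 2)) then (x + 1) * x ^ (d + m - 1) * x ^ (j - (d + m / 2)) else 0) else 0) := by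
    intro j hj
    rw [Finset.mem_range] at hj
    rw [rowM_eval_v5 x hx0 hd hm hdjl nM vM hnM hv0M hvOffM hvLowM hvTopM j (by omega)]
    congr 1
    · congr 1
      · by_cases hjd : j < d
        · rw [if_pos (show 0 ≤ j ∧ j < 0 + d from ⟨Nat.zero_le _, by omega⟩)]
          by_cases hp : j % 2 ≠ d % 2
          · rw [if_pos ⟨hjd, hp⟩, if_pos hp]
          · rw [if_neg (fun h => hp h.2), if_neg hp]
        · rw [if_neg (fun h => hjd h.1), if_neg (show ¬ (0 ≤ j ∧ j < 0 + d) from fun h => by omega)]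
      · by_cases hc : d ≤ j ∧ j ≤ d - 1 + m / 2
        · rw [if_pos hc, if_pos (show d ≤ j ∧ j < d + m / 2 from by omega), mul_assoc, ← pow_add]
          congr 2; omega
        · rw [if_neg hc, if_neg (show ¬ (d ≤ j ∧ j < d + m / 2) from fun h => hc (by omega))]
    · by_cases hg : jl + 1 = d + m
      · rw [if_pos hg]
        by_cases hw : d + m / 2 ≤ j ∧ 2 * j + d ≤ 2 * jl + 1
        · rw [if_pos (show d + m / 2 ≤ j ∧ 2 * j + d ≤ 2 * jl + 1 ∧ jl + 1 = d + m from ⟨hw.1, hw.2, hg⟩),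
            if_pos (show d + m / 2 ≤ j ∧ j < d + m / 2 + ((2 * jl + 1 - d) / 2 + 1 - (d + m / 2)) from by omega), mul_assoc, ← pow_add]
          congr 2; omega
        · rw [if_neg (show ¬ (d + m / 2 ≤ j ∧ 2 * j + d ≤ 2 * jl + 1 ∧ jl + 1 = d + m) from fun h => hw ⟨h.1, h.2.1⟩),
            if_neg (show ¬ (d + m / 2 ≤ j ∧ j < d + m / 2 + ((2 * jl + 1 - d) / 2 + 1 - (d + m / 2))) from fun h => hw (by omega))]
      · rw [if_neg hg, if_neg (show ¬ (d + m / 2 ≤ j ∧ 2 * j + d ≤ 2 * jl + 1 ∧ jl + 1 = d + m) from fun h => hg h.2.2)]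
  rw [Finset.sum_congr rfl hrows, Finset.sum_add_distrib, Finset.sum_add_distrib,
    sum_range_window_reindex _ (by omega : 0 + d ≤ jl + 1), sum_range_window_reindex _ (by omega : d + m / 2 ≤ jl + 1)]
  have htop : ∑ j ∈ range (jl + 1), (if jl + 1 = d + m then
      (if d + m / 2 ≤ j ∧ j < d + m / 2 + ((2 * jl + 1 - d) / 2 + 1 - (d + m / 2)) then (x + 1) * x ^ (d + m - 1) * x ^ (j - (d + m / 2)) else 0) else 0) =
      (if jl + 1 = d + m then (x + 1) * x ^ (d + m - 1) * ∑ i ∈ range ((2 * jl + 1 - d) / 2 + 1 - (d + m / 2)), x ^ i else 0) := by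
    by_cases hg : jl + 1 = d + m
    · simp_rw [if_pos hg]
      rw [sum_range_window_reindex _ (by omega : d + m / 2 + ((2 * jl + 1 - d) / 2 + 1 - (d + m / 2)) ≤ jl + 1), Finset.mul_sum]
      refine Finset.sum_congr rfl fun i _ => ?_
      rw [show d + m / 2 + i - (d + m / 2) = i by omega]
    · simp_rw [if_neg hg]
      rw [Finset.sum_const_zero]
  have hmid : ∑ i ∈ range (m / 2), (x + 1) * x ^ d * x ^ (2 * (d + i - d)) = (x + 1) * x ^ d * ∑ i ∈ range (m / 2), x ^ (2 * i) := by
    rw [Finset.mul_sum]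
    refine Finset.sum_congr rfl fun i _ => ?_
    rw [show d + i - d = i by omega]
  rw [htop, hmid]
  simp_rw [Nat.zero_add]

end Summit.HodgeConjecture.HodgeConjecture.Cruxes.H413.F0P3cDyRamToricCensusSumUnrV5Parts
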